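import Summits.CriticalPhenomena.PercolationContinuityZ3.Theorems.PercNearOneGluingNoHeavyLowerTailSahiE3DeterminedMeetFKGCube
import Summits.CriticalPhenomena.PercolationContinuityZ3.Theorems.PercNearOneGluingNoHeavyLowerTailSahiC3CubeThreeFKGPrelim
import Mathlib.Tactic.Linarith
import HarnessLib
import HarnessLib.Audit

/-!
# `NoHeavyLowerTail` (crux stmt-CriticalPhenomena-4575), Sahi programme P4: code-level bridges for assembling Sahi's `C₃` on `{0,1}⁴` (FKG weights)

Support file (cell `prim-l12`, seat P4; `--supports stmt-CriticalPhenomena-4575`).  No named facts, no sorries; standard axioms.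

The assembly of the landed orbit theorems (`SahiC3CubeFourFKG.orbit*_nonneg`) into one statement over all up-set triples of the `4`-cube goes
through a kernel-checked table on set CODES (`encF 4`, HOME prim-l12-p4/ASSEMBLY-PLAN-FKG-CUBE4.md).  This file turns the table's code-level
reasons into the hypotheses of the tree theorems: (1) an EMPTY slot gives `latticeE3 = 0` (`latticeE3_empty₃` and code form); (2) a slot whose code is a
cone is `principalUp (ptB m c)` (`eq_principalUp_of_code`), so `latticeE3_nonneg_of_principal` applies; (3) a pairwise intersection whose code does not
depend on coordinate `i` (`indepCoordB`, a Boolean test on the code) satisfies the hypothesis of the cube locality corollary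
`SahiE3DeterminedMeetFKG.latticeE3_nonneg_cube_of_inter_determined_three` with `e = Fin.succAbove i` (`latticeE3_nonneg_of_indepCoord` and slot variants).
-/

namespace Summit.CriticalPhenomena.PercolationContinuityZ3.Theorems.SahiC3CubeFourFKG

open Finset Literature.Probability.LatticeModels SahiC3Cube OneCutCert SahiE3DeterminedMeetFKG

/-! ### Empty slot -/

/-- An empty third slot kills `latticeE3`. [this work] -/
theorem latticeE3_empty₃ {α : Type*} [Fintype α] [DecidableEq α] (μ : α → ℝ) (U A : Finset α) : latticeE3 μ U A ∅ = 0 := by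
  simp [latticeE3, mass]

/-- An empty slot (by code) kills `latticeE3`. [this work] -/
theorem latticeE3_eq_zero_of_code₃ {m : ℕ} (μ : (Fin m → Bool) → ℝ) {U A B : Finset (Fin m → Bool)} (hB : encF m B = 0) :
    latticeE3 μ U A B = 0 := by
  rw [eq_empty_of_encF hB]; exact latticeE3_empty₃ μ U A

/-! ### Principal slot from the code -/

/-- `ptB m c ≤ x` iff the bits of `c` (below `m`) are among the coordinates of `x`. [this work] -/
theorem ptB_le_iff {m c : ℕ} (x : Fin m → Bool) : ptB m c ≤ x ↔ ∀ i : Fin m, c.testBit i = true → x i = true := by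
  constructor
  · intro h i hi
    have := h i
    rw [show ptB m c i = c.testBit i from rfl, hi] at this
    exact top_le_iff.1 this
  · intro h i
    show c.testBit i ≤ x i
    cases hc : c.testBit i
    · exact bot_le
    · rw [h i hc]

/-- **Principal slot from the code**: if bit `j` of the code of `S` is set exactly when `c AND j = c` (for `j < 2^m`), then `S = principalUp (ptB m c)`
(for `c < 2^m`). [this work] -/
theorem eq_principalUp_of_code {m c : ℕ} (hc : c < 2 ^ m) {S : Finset (Fin m → Bool)}
    (h : ∀ j < 2 ^ m, (encF m S).testBit j = decide (c &&& j = c)) : S = principalUp (ptB m c) := by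
  ext x
  rw [mem_principalUp, mem_iff_testBit_encF, h _ (enc2_lt x), decide_eq_true_iff, ptB_le_iff]
  constructor
  · intro hcx i hi
    have := congrArg (fun n => n.testBit i) hcx
    simp only [Nat.testBit_land, hi, Bool.true_and] at this
    rw [SahiC3Cube.testBit_enc2, dif_pos i.2] at this
    exact this
  · intro hx
    refine Nat.eq_of_testBit_eq fun t => ?_
    rw [Nat.testBit_land]
    by_cases ht : t < m
    · rw [SahiC3Cube.testBit_enc2, dif_pos ht]
      cases hct : c.testBit t
      · rfl
      · simpa using hx ⟨t, ht⟩ hct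
    · have hle : 2 ^ m ≤ 2 ^ t := Nat.pow_le_pow_right (by norm_num) (not_lt.1 ht)
      rw [Nat.testBit_lt_two_pow (lt_of_lt_of_le hc hle)]
      simp

/-! ### A pairwise intersection independent of one coordinate -/

/-- Code-level Boolean test: membership in the set with code `k` does not depend on coordinate `i` of the `m`-cube. [this work] -/
def indepCoordB (m k i : ℕ) : Bool := (List.range (2 ^ m)).all fun j => k.testBit j == k.testBit (j ^^^ 2 ^ i)

/-- Reading off one bit from `indepCoordB`. [this work] -/
theorem testBit_eq_of_indepCoordB {m k i : ℕ} (h : indepCoordB m k i = true) {j : ℕ} (hj : j < 2 ^ m) :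
    k.testBit j = k.testBit (j ^^^ 2 ^ i) := by
  unfold indepCoordB at h
  rw [List.all_eq_true] at h
  simpa using h j (List.mem_range.2 hj)

/-- Flipping coordinate `i` XORs the corner position with `2^i`. [this work] -/
theorem enc2_update_not {m : ℕ} (x : Fin m → Bool) (i : Fin m) :
    enc2 (Function.update x i (!x i)) = enc2 x ^^^ 2 ^ (i : ℕ) := by
  refine Nat.eq_of_testBit_eq fun t => ?_
  rw [Nat.testBit_xor, Nat.testBit_two_pow]
  by_cases ht : t < m
  · rw [SahiC3Cube.testBit_enc2, dif_pos ht, SahiC3Cube.testBit_enc2, dif_pos ht]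
    by_cases hti : (⟨t, ht⟩ : Fin m) = i
    · subst hti
      simp
    · rw [Function.update_of_ne hti]
      have : (i : ℕ) ≠ t := fun h => hti (Fin.ext h.symm)
      simp [this]
  · rw [testBit_enc2_of_le _ _ (not_lt.1 ht), testBit_enc2_of_le _ _ (not_lt.1 ht)]
    have : (i : ℕ) ≠ t := fun h => ht (h ▸ i.2)
    simp [this]

/-- If the code of `S` does not depend on coordinate `i`, then membership in `S` only depends on the other coordinates. [this work] -/
theorem mem_iff_of_indepCoord {m : ℕ} {S : Finset (Fin m → Bool)} {i : Fin m} (h : indepCoordB m (encF m S) i = true) (x y : Fin m → Bool)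
    (hxy : ∀ j, j ≠ i → x j = y j) : (x ∈ S ↔ y ∈ S) := by
  by_cases hi : x i = y i
  · have : x = y := funext fun j => by by_cases hj : j = i <;> [exact hj ▸ hi; exact hxy j hj]
    rw [this]
  · have hy : y = Function.update x i (!x i) := by
      funext j
      by_cases hj : j = i
      · subst hj; rw [Function.update_self]
        cases hx : x j <;> cases hy' : y j <;> simp_all
      · rw [Function.update_of_ne hj, hxy j hj]
    rw [mem_iff_testBit_encF, mem_iff_testBit_encF, hy, enc2_update_not, ← testBit_eq_of_indepCoordB h (enc2_lt x)]

/-- Agreement along `Fin.succAbove i` is agreement off coordinate `i`. [folklore] -/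
theorem agree_off_of_comp_succAbove {m : ℕ} {i : Fin (m + 1)} {x y : Fin (m + 1) → Bool} (h : x ∘ Fin.succAbove i = y ∘ Fin.succAbove i)
    (j : Fin (m + 1)) (hj : j ≠ i) : x j = y j := by
  obtain ⟨t, rfl⟩ := Fin.exists_succAbove_eq hj
  exact congrFun h t

variable {μ : (Fin 4 → Bool) → ℝ}

/-- **Junta bridge (slots `A, B`)**: if the code of `A ∩ B` does not depend on coordinate `i`, then `0 ≤ latticeE3 μ U A B` for every nonnegative
log-supermodular weight on `{0,1}⁴` (cube locality corollary with `e = Fin.succAbove i`). [this work] -/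
theorem latticeE3_nonneg_of_indepCoord (hμ₀ : 0 ≤ μ) (hμ : ∀ a b, μ a * μ b ≤ μ (a ⊓ b) * μ (a ⊔ b))
    {U A B : Finset (Fin 4 → Bool)} (hU : IsUpperSet (U : Set (Fin 4 → Bool))) (hA : IsUpperSet (A : Set (Fin 4 → Bool)))
    (hB : IsUpperSet (B : Set (Fin 4 → Bool))) (i : Fin 4) (h : indepCoordB 4 (encF 4 A &&& encF 4 B) i = true) : 0 ≤ latticeE3 μ U A B := by
  rw [← encF_inter] at h
  exact latticeE3_nonneg_cube_of_inter_determined_three hμ₀ hμ (e := Fin.succAbove i) Fin.succAbove_right_injective hU hA hB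
    fun x y hxy => mem_iff_of_indepCoord h x y (agree_off_of_comp_succAbove hxy)

/-- Junta bridge, slots `U, A`. [this work] -/
theorem latticeE3_nonneg_of_indepCoord₁₂ (hμ₀ : 0 ≤ μ) (hμ : ∀ a b, μ a * μ b ≤ μ (a ⊓ b) * μ (a ⊔ b))
    {U A B : Finset (Fin 4 → Bool)} (hU : IsUpperSet (U : Set (Fin 4 → Bool))) (hA : IsUpperSet (A : Set (Fin 4 → Bool)))
    (hB : IsUpperSet (B : Set (Fin 4 → Bool))) (i : Fin 4) (h : indepCoordB 4 (encF 4 U &&& encF 4 A) i = true) : 0 ≤ latticeE3 μ U A B := by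
  rw [← encF_inter] at h
  exact latticeE3_nonneg_cube_of_inter_determined_three₁₂ hμ₀ hμ (e := Fin.succAbove i) Fin.succAbove_right_injective hU hA hB
    fun x y hxy => mem_iff_of_indepCoord h x y (agree_off_of_comp_succAbove hxy)

/-- Junta bridge, slots `U, B`. [this work] -/
theorem latticeE3_nonneg_of_indepCoord₁₃ (hμ₀ : 0 ≤ μ) (hμ : ∀ a b, μ a * μ b ≤ μ (a ⊓ b) * μ (a ⊔ b))
    {U A B : Finset (Fin 4 → Bool)} (hU : IsUpperSet (U : Set (Fin 4 → Bool))) (hA : IsUpperSet (A : Set (Fin 4 → Bool)))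
    (hB : IsUpperSet (B : Set (Fin 4 → Bool))) (i : Fin 4) (h : indepCoordB 4 (encF 4 U &&& encF 4 B) i = true) : 0 ≤ latticeE3 μ U A B := by
  rw [← encF_inter] at h
  exact latticeE3_nonneg_cube_of_inter_determined_three₁₃ hμ₀ hμ (e := Fin.succAbove i) Fin.succAbove_right_injective hU hA hB
    fun x y hxy => mem_iff_of_indepCoord h x y (agree_off_of_comp_succAbove hxy)

/-- **Principal-slot bridge**: a third slot whose code is the cone of `c` gives `0 ≤ latticeE3 μ U A B` [Sahi 2008 / Blinovsky 2013 via the tree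
theorem `latticeE3_nonneg_of_principal`]. -/
theorem latticeE3_nonneg_of_coneCode₃ (hμ₀ : 0 ≤ μ) (hμ : ∀ a b, μ a * μ b ≤ μ (a ⊓ b) * μ (a ⊔ b))
    {U A B : Finset (Fin 4 → Bool)} (hU : IsUpperSet (U : Set (Fin 4 → Bool))) (hA : IsUpperSet (A : Set (Fin 4 → Bool)))
    {c : ℕ} (hc : c < 2 ^ 4) (h : ∀ j < 2 ^ 4, (encF 4 B).testBit j = decide (c &&& j = c)) : 0 ≤ latticeE3 μ U A B := by
  rw [eq_principalUp_of_code hc h]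
  exact latticeE3_nonneg_of_principal hμ₀ hμ hU hA _

end Summit.CriticalPhenomena.PercolationContinuityZ3.Theorems.SahiC3CubeFourFKG
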